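import Literature.AlgebraicGeometry.HodgeTheory.BettiUniverseAxioms
import Literature.AlgebraicGeometry.Motives.WeilTypeCM
import HarnessLib

/-!
# The rational CM action on `H¹(A(ℂ); ℚ)` descended from an integral action on `H¹(A(ℂ); ℂ)`

Family `hodge`, layer `Literature/AlgebraicGeometry/HodgeTheory`. Theorems and three definitions; no
named fact is introduced; continuation of `BettiUniverseAxioms` in its LIGHT form (revision): the
declarations touching the Hodge structure `hodge hHD hA 1` take the same explicit hypotheses
`(hHD : exists_isReal_hodgeModel) (hI : hodgePQ_independent_of_hodgeModel)` as that file, placed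
right after the section data `θ hθ` and before `hA` (`cmEndAction θ hθ hHD hI hA`,
`mem_hodge_piece_iff hHD hI hX …`); both are theorems of the tree
(`exists_isReal_hodgeModel_holds`, `hodgePQ_independent_of_hodgeModel_holds`), not imported here.

Setting (the shape in which the existence of CM abelian varieties is recorded in the tree,
`PicardCM.CMAbelianVarietyRealised`, conjunct (iii) of `PicardCMPrerequisites`): a smooth projective
`A/ℂ` of dimension `g`, a number field `K` and a ring homomorphism
`θ : K → End_ℂ H¹(A(ℂ); ℂ)` such that `θ(a)` is the pull-back `f_a^*` along an endomorphism
`f_a : A → A` of the variety for every algebraic integer `a ∈ 𝓞_K`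
(`BettiUniverse.IsInducedOnIntegers θ`).

* `BettiUniverse.cmAction θ hθ : K →ₐ[ℚ] End_ℚ H¹(A(ℂ); ℚ)` — **the rational CM action**: the
  unique `ℚ`-algebra map whose complexification is `θ` under the rational lattice
  `H¹(A(ℂ); ℚ) ↪ H¹(A(ℂ); ℂ)` (`BettiUniverse.ofRatClass_cmAction`:
  `(cmAction k v) ⊗ 1 = θ(k) (v ⊗ 1)`; `BettiUniverse.ofRatClassBaseChange_cmAction_baseChange`).
  Construction: on an integral basis `(b_i)` of `K/ℚ` (`NumberField.integralBasis`) it is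
  `b_i ↦ f_{b_i}^*` on `H¹(A(ℂ); ℚ)` (`Motives.bettiCohomology.map`), extended `ℚ`-linearly
  (`Module.Basis.constr`); it intertwines with `θ` because the rational lattice is natural
  (`Motives.ofRatClass_map`) and `θ` is `ℚ`-linear (`BettiUniverse.ringHom_ratCast_smul`), and it is
  multiplicative and unital because `θ` is and the lattice map is injective (`ofRatClass_injective`).
* `BettiUniverse.cmEndAction θ hθ hHD hI hA : HodgeStructure.EndAction (hodge hHD hA 1) K` — the action
  is by endomorphisms of the `ℚ`-Hodge structure `hodge hHD hA 1` of `BettiUniverseAxioms`: each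
  `cmAction k ⊗ ℂ` is a `ℚ`-linear combination of the pull-backs `f_{b_i}^* ⊗ ℂ`, which preserve
  the Hodge filtration (`BettiUniverse.pull_hodge`). (Deligne, LNM 900, §4; Shimura 1998, §3.2,
  §5.2: `ι : K → End⁰(A)` acting on `H¹(A, ℚ)`.)
* `BettiUniverse.map_eigenspaces_cmEndAction` — under `β : ℂ ⊗_ℚ H¹(A(ℂ); ℚ) ≃ H¹(A(ℂ); ℂ)`
  (`ofRatClassBaseChangeEquiv`) the joint `σ`-eigenspace of the complexified rational action is the
  joint `σ`-eigenspace of `θ`, for every `σ : K → ℂ`; hence they have the same dimension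
  (`BettiUniverse.finrank_eigenspaces_cmEndAction`).

* `BettiUniverse.mem_hodge_F_self_iff` (`mem_hodge_F_one_iff`) — the model-free reading
  `Fᵏ(ℂ ⊗_ℚ Hᵏ) = Θ'⁻¹(H^{k,0})`: `x ∈ (hodge hHD hX k).F k ↔ IsOfHodgeType n X k k 0 (Θ' x)`, by which
  consumers recognise classes of holomorphic forms (theta one-forms, `k = 1`) in the filtration of
  `hodge hHD hX k` without opening the chosen real Hodge model; `mem_hodge_piece_iff`
  (`mem_hodge_piece_one_zero_iff`, `mem_hodge_piece_two_zero_iff`) — the same for the pieces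
  `V^{p,q} = Fᵖ ∩ conj F^q` of `hodge hHD hX k`: `x ∈ (hodge hHD hX k).piece p q ↔ IsOfHodgeType n X k p q (Θ' x)`
  (an axiomatic consumer's `H¹·⁰(X) := (hodge X 1).piece 1 0`).

Design. The hypothesis is consumed in exactly the tree's recorded shape, so that a consumer holding
`h : PicardCM.CMAbelianVarietyRealised` instantiates `A, θ, hθ` by `Classical.choice` from `h K Φ`
and obtains the `Universe` field `cmAct K Φ := cmEndAction θ hθ hHD hI hA`.

Not here: the CM type read on `H^{1,0}` (it is part of the recorded hypothesis, transported by
`map_eigenspaces_cmEndAction` when needed), Albanese varieties, polarisations, the Rosati involution.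

## References

* [Deligne1982HodgeCycles] P. Deligne (notes by J. Milne), *Hodge cycles on abelian varieties*,
  LNM 900 (1982), §4 (`E ↪ End⁰(A)` acting on `H¹(A, ℚ)` by Hodge endomorphisms), §5.
* [Shimura1998] G. Shimura, *Abelian Varieties with Complex Multiplication and Modular Functions*,
  Princeton 1998, §3.2 pp. 20–22 (the rational representation), §5.2 pp. 36–37, §6.2 Thm. 3.
* [HatcherAT2002] A. Hatcher, *Algebraic Topology*, CUP 2002, §3.1 p. 198 (change of coefficients
  is natural).
-/

noncomputable section

open scoped TensorProduct
open CategoryTheory Module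
open Literature.AlgebraicTopology.SingularHomology
open Literature.AlgebraicGeometry.Motives (bettiCohomology ofRatClassBaseChange ofRatClassBaseChange_tmul)
open NumberField

namespace Literature.AlgebraicGeometry.HodgeTheory

namespace BettiUniverse

section CMAction

variable {g : ℕ} {A : Motives.SchemeOver ℂ} {K : Type} [Field K] [NumberField K]

/-- **`θ` is induced by endomorphisms of the variety on the integers**: for every `a ∈ 𝓞_K` there is
`f_a : A → A` with `f_a^* = θ(a)` on `H¹(A(ℂ); ℂ)` — the recorded shape of "`ι(α) ∈ End(A)` for
`α ∈ 𝔬`" (Shimura 1998 §6.2 Thm. 3; the tree's `PicardCM.CMAbelianVarietyRealised`).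
[cite: Shimura1998, §6.2 Theorem 3, pp. 41–42] -/
def IsInducedOnIntegers (θ : K →+* Module.End ℂ (complexBetti A 1)) : Prop :=
  ∀ a : 𝓞 K, ∃ f : A ⟶ A, (complexBetti.map f 1).hom = θ (a : K)

variable (θ : K →+* Module.End ℂ (complexBetti A 1)) (hθ : IsInducedOnIntegers θ)

/-- A ring homomorphism from a number field into the `ℂ`-linear endomorphisms of a `ℂ`-vector space
sends a rational number `q` to the homothety `q`: `θ(q) w = q • w`. [folklore] -/
theorem ringHom_ratCast_apply {M : Type*} [AddCommGroup M] [Module ℂ M]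
    (θ : K →+* Module.End ℂ M) (q : ℚ) (w : M) : θ (q : K) w = (q : ℂ) • w := by
  have hden : (q.den : ℂ) ≠ 0 := by exact_mod_cast q.den_ne_zero
  have h1 : θ (q : K) * θ (q.den : K) = θ (q.num : K) := by
    rw [← map_mul]; congr 1; exact_mod_cast Rat.mul_den_eq_num q
  have h2 := congrArg (fun φ : Module.End ℂ M ↦ φ w) h1
  simp only [Module.End.mul_apply, map_natCast, map_intCast, Module.End.natCast_apply,
    Module.End.intCast_apply] at h2
  rw [← Nat.cast_smul_eq_nsmul ℂ, map_smul, ← Int.cast_smul_eq_zsmul ℂ] at h2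
  -- `h2 : (den : ℂ) • θ q w = (num : ℂ) • w`
  have h3 : θ (q : K) w = ((q.den : ℂ)⁻¹ * (q.num : ℂ)) • w := by
    rw [mul_smul, ← h2, smul_smul, inv_mul_cancel₀ hden, one_smul]
  rw [h3, Rat.cast_def, div_eq_inv_mul]

/-- `θ (q • k) = q • θ k` pointwise, for `q ∈ ℚ`. [folklore] -/
theorem ringHom_rat_smul_apply {M : Type*} [AddCommGroup M] [Module ℂ M]
    (θ : K →+* Module.End ℂ M) (q : ℚ) (k : K) (w : M) :
    θ (q • k) w = (q : ℂ) • θ k w := by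
  rw [Rat.smul_def, map_mul, Module.End.mul_apply, ringHom_ratCast_apply]

/-- The endomorphism of `A` chosen to induce `θ(b_i)` for the `i`-th vector of the integral basis of
`K`. [folklore] -/
def cmPull (i : Free.ChooseBasisIndex ℤ (𝓞 K)) : A ⟶ A :=
  (hθ (RingOfIntegers.basis K i)).choose

/-- `f_{b_i}^* = θ(b_i)` on `H¹(A(ℂ); ℂ)`. [folklore] -/
theorem cmPull_spec (i : Free.ChooseBasisIndex ℤ (𝓞 K)) :
    (complexBetti.map (cmPull θ hθ i) 1).hom = θ (integralBasis K i) := by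
  rw [integralBasis_apply]
  exact (hθ (RingOfIntegers.basis K i)).choose_spec

/-- The rational CM action as a `ℚ`-linear map `K → End_ℚ H¹(A(ℂ); ℚ)`: `b_i ↦ f_{b_i}^*` on the
integral basis, extended linearly. [folklore] -/
def cmActionLin : K →ₗ[ℚ] Module.End ℚ (bettiCohomology A 1) :=
  (integralBasis K).constr ℚ fun i ↦ pull (cmPull θ hθ i) 1

/-- On the integral basis the rational action is the chosen pull-back. [folklore] -/
theorem cmActionLin_basis (i : Free.ChooseBasisIndex ℤ (𝓞 K)) :
    cmActionLin θ hθ (integralBasis K i) = pull (cmPull θ hθ i) 1 :=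
  Module.Basis.constr_basis _ _ _ _

/-- **The rational action complexifies to `θ`** on the rational lattice:
`(cmActionLin k v) ⊗ 1 = θ(k) (v ⊗ 1)` in `H¹(A(ℂ); ℂ)`. [cite: HatcherAT2002, §3.1 p. 198] -/
theorem ofRatClass_cmActionLin (k : K) (v : bettiCohomology A 1) :
    ofRatClass (Motives.ComplexPoints A) 1 (cmActionLin θ hθ k v) =
      θ k (ofRatClass (Motives.ComplexPoints A) 1 v) := by
  have key : ∀ i, ofRatClass (Motives.ComplexPoints A) 1 (cmActionLin θ hθ (integralBasis K i) v) =
      θ (integralBasis K i) (ofRatClass (Motives.ComplexPoints A) 1 v) := by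
    intro i
    rw [cmActionLin_basis, ← cmPull_spec θ hθ i]
    exact Motives.ofRatClass_map 1 (Motives.AlgPoints.mapContinuous (L := ℂ) (cmPull θ hθ i)) v
  rw [← (integralBasis K).sum_repr k]
  simp only [map_sum, map_smul, LinearMap.sum_apply, LinearMap.smul_apply, Motives.ofRatClass_smul,
    ringHom_rat_smul_apply, key]

/-- The rational action is multiplicative. [folklore] -/
theorem cmActionLin_mul (x y : K) :
    cmActionLin θ hθ (x * y) = cmActionLin θ hθ x * cmActionLin θ hθ y := by
  refine LinearMap.ext fun v ↦ ofRatClass_injective 1 ?_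
  rw [ofRatClass_cmActionLin, map_mul, Module.End.mul_apply, Module.End.mul_apply,
    ofRatClass_cmActionLin, ofRatClass_cmActionLin]

/-- The rational action is unital. [folklore] -/
theorem cmActionLin_one : cmActionLin θ hθ 1 = 1 := by
  refine LinearMap.ext fun v ↦ ofRatClass_injective 1 ?_
  rw [ofRatClass_cmActionLin, map_one, Module.End.one_apply, Module.End.one_apply]

/-- **The rational CM action** `K →ₐ[ℚ] End_ℚ H¹(A(ℂ); ℚ)` descended from `θ`
(Shimura 1998 §3.2: the rational representation of `End⁰(A)` on `H¹(A, ℚ)`).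
[cite: Shimura1998, §3.2, pp. 20–22] -/
def cmAction : K →ₐ[ℚ] Module.End ℚ (bettiCohomology A 1) :=
  AlgHom.ofLinearMap (cmActionLin θ hθ) (cmActionLin_one θ hθ) (cmActionLin_mul θ hθ)

/-- `cmAction` is `cmActionLin` on elements. [folklore] -/
@[simp]
theorem cmAction_apply (k : K) : cmAction θ hθ k = cmActionLin θ hθ k := rfl

/-- **`cmAction ⊗ 1 = θ` on the rational lattice**: `(cmAction k v) ⊗ 1 = θ(k) (v ⊗ 1)`.
[cite: Shimura1998, §3.2, pp. 20–22] -/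
theorem ofRatClass_cmAction (k : K) (v : bettiCohomology A 1) :
    ofRatClass (Motives.ComplexPoints A) 1 (cmAction θ hθ k v) =
      θ k (ofRatClass (Motives.ComplexPoints A) 1 v) :=
  ofRatClass_cmActionLin θ hθ k v

/-- **`β ∘ (cmAction k ⊗ ℂ) = θ(k) ∘ β`** for the comparison `β : ℂ ⊗_ℚ H¹(A(ℂ); ℚ) → H¹(A(ℂ); ℂ)`
(`ofRatClassBaseChange`). [cite: VoisinHodgeI2002, §7.1.1] -/
theorem ofRatClassBaseChange_cmAction (k : K) (t : ℂ ⊗[ℚ] bettiCohomology A 1) :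
    ofRatClassBaseChange (Motives.ComplexPoints A) 1 ((cmAction θ hθ k).baseChange ℂ t) =
      θ k (ofRatClassBaseChange (Motives.ComplexPoints A) 1 t) := by
  induction t using TensorProduct.induction_on with
  | zero => rw [map_zero, map_zero, map_zero]
  | tmul c v =>
    rw [LinearMap.baseChange_tmul, ofRatClassBaseChange_tmul, ofRatClassBaseChange_tmul, map_smul,
      ofRatClass_cmAction]
  | add x y hx hy => simp only [map_add, hx, hy]

/-- The complexification of a `ℚ`-linear combination, evaluated: `(∑ cᵢ fᵢ) ⊗ ℂ = ∑ cᵢ (fᵢ ⊗ ℂ)`.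
[folklore] -/
theorem baseChange_sum_smul_apply {ι V W : Type*} [Fintype ι] [AddCommGroup V] [Module ℚ V]
    [AddCommGroup W] [Module ℚ W] (c : ι → ℚ) (f : ι → V →ₗ[ℚ] W) (x : ℂ ⊗[ℚ] V) :
    (∑ i, c i • f i).baseChange ℂ x = ∑ i, (c i : ℂ) • (f i).baseChange ℂ x := by
  induction x using TensorProduct.induction_on with
  | zero => simp only [map_zero, smul_zero, Finset.sum_const_zero]
  | tmul a v =>
    simp only [LinearMap.baseChange_tmul, LinearMap.sum_apply, LinearMap.smul_apply,
      TensorProduct.tmul_sum, TensorProduct.tmul_smul]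
    refine Finset.sum_congr rfl fun i _ ↦ ?_
    rw [← algebraMap_smul ℂ (c i), eq_ratCast]
  | add x y hx hy => simp only [map_add, hx, hy, smul_add, Finset.sum_add_distrib]

/-- Expansion of the rational action on the integral basis: `cmAction k = ∑ᵢ kᵢ f_{b_i}^*`.
[folklore] -/
theorem cmAction_eq_sum (k : K) :
    (cmAction θ hθ k : Module.End ℚ (bettiCohomology A 1)) =
      ∑ i, (integralBasis K).repr k i • pull (cmPull θ hθ i) 1 := by
  rw [cmAction_apply]
  conv_lhs => rw [← (integralBasis K).sum_repr k]
  simp only [map_sum, map_smul, cmActionLin_basis]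

/-- **The rational CM action preserves the Hodge filtration** of `hodge hHD hA 1`: each
`cmAction k ⊗ ℂ` is a `ℚ`-combination of pull-backs `f_{b_i}^* ⊗ ℂ`, morphisms of Hodge structures
(`pull_hodge`). (Deligne, LNM 900, §4.) [cite: Deligne1982HodgeCycles, §4] -/
theorem cmAction_map_F_le (hHD : exists_isReal_hodgeModel) (hI : hodgePQ_independent_of_hodgeModel)
    (hA : Motives.IsSmoothProjective g A) (k : K) (p : ℤ) :
    ((hodge hHD hA 1).F p).map ((cmAction θ hθ k).baseChange ℂ) ≤ (hodge hHD hA 1).F p := by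
  rw [Submodule.map_le_iff_le_comap]
  intro x hx
  rw [Submodule.mem_comap, cmAction_eq_sum, baseChange_sum_smul_apply]
  refine Submodule.sum_mem _ fun i _ ↦ Submodule.smul_mem _ _ ?_
  exact pull_hodge hHD hI hA hA (cmPull θ hθ i) 1 p (Submodule.mem_map_of_mem hx)

/-- **The CM action by endomorphisms of the `ℚ`-Hodge structure `hodge hHD hA 1`** — the `Universe`
field `cmAct` of an axiomatic consumer, for the variety and action recorded by
`PicardCM.CMAbelianVarietyRealised`. [cite: Deligne1982HodgeCycles, §4]
[cite: Shimura1998, §3.2, pp. 20–22] -/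
def cmEndAction (hHD : exists_isReal_hodgeModel) (hI : hodgePQ_independent_of_hodgeModel)
    (hA : Motives.IsSmoothProjective g A) :
    Motives.HodgeStructure.EndAction (hodge hHD hA 1) K where
  ι := cmAction θ hθ
  map_F_le := cmAction_map_F_le θ hθ hHD hI hA

/-- The action map of `cmEndAction` is `cmAction`. [folklore] -/
@[simp]
theorem cmEndAction_ι (hHD : exists_isReal_hodgeModel) (hI : hodgePQ_independent_of_hodgeModel)
    (hA : Motives.IsSmoothProjective g A) :
    (cmEndAction θ hθ hHD hI hA).ι = cmAction θ hθ := rfl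

/-- **Joint eigenspaces correspond under `β`**: for `σ : K → ℂ`, the image under
`β : ℂ ⊗_ℚ H¹(A(ℂ); ℚ) ≃ H¹(A(ℂ); ℂ)` of the joint `σ`-eigenspace of the complexified rational action
is the joint `σ`-eigenspace of `θ` (the `σ`-eigenline of the record). [cite: Deligne1982HodgeCycles, §4] -/
theorem map_eigenspaces_cmEndAction (hHD : exists_isReal_hodgeModel)
    (hI : hodgePQ_independent_of_hodgeModel) (hA : Motives.IsSmoothProjective g A) (σ : K →+* ℂ) :
    Submodule.map (ofRatClassBaseChangeEquiv hA 1).toLinearMap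
        (⨅ e : K, Module.End.eigenspace (((cmEndAction θ hθ hHD hI hA).ι e).baseChange ℂ) (σ e)) =
      ⨅ a : K, Module.End.eigenspace (θ a) (σ a) := by
  ext w
  simp only [Submodule.mem_map, Submodule.mem_iInf, Module.End.mem_eigenspace_iff, cmEndAction_ι,
    LinearEquiv.coe_toLinearMap, ofRatClassBaseChangeEquiv_apply]
  constructor
  · rintro ⟨t, ht, rfl⟩ a
    rw [← ofRatClassBaseChange_cmAction θ hθ, ht a, map_smul]
  · intro hw
    refine ⟨(ofRatClassBaseChangeEquiv hA 1).symm w, fun a ↦ ?_, ?_⟩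
    · apply (ofRatClassBaseChangeEquiv hA 1).injective
      rw [ofRatClassBaseChangeEquiv_apply, ofRatClassBaseChangeEquiv_apply, ofRatClassBaseChange_cmAction,
        map_smul, ← ofRatClassBaseChangeEquiv_apply hA, LinearEquiv.apply_symm_apply, hw a]
    · rw [← ofRatClassBaseChangeEquiv_apply hA, LinearEquiv.apply_symm_apply]

/-- **Joint eigenspaces have the same dimension** on both sides of `β`. [folklore] -/
theorem finrank_eigenspaces_cmEndAction (hHD : exists_isReal_hodgeModel)
    (hI : hodgePQ_independent_of_hodgeModel) (hA : Motives.IsSmoothProjective g A) (σ : K →+* ℂ) :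
    Module.finrank ℂ ↥(⨅ e : K, Module.End.eigenspace (((cmEndAction θ hθ hHD hI hA).ι e).baseChange ℂ) (σ e)) =
      Module.finrank ℂ ↥(⨅ a : K, Module.End.eigenspace (θ a) (σ a)) := by
  rw [← map_eigenspaces_cmEndAction θ hθ hHD hI hA σ, LinearEquiv.finrank_map_eq]

/-- `dim_ℚ H¹(A(ℂ); ℚ) = dim_ℂ H¹(A(ℂ); ℂ)` (`β` is an isomorphism). [cite: VoisinHodgeI2002, §7.1.1] -/
theorem finrank_bettiCohomology_eq (hA : Motives.IsSmoothProjective g A) (k : ℕ) :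
    Module.finrank ℚ (bettiCohomology A k) = Module.finrank ℂ (complexBetti A k) := by
  rw [← (ofRatClassBaseChangeEquiv hA k).finrank_eq, Module.finrank_baseChange]

end CMAction

section HodgeFiltration

variable {n : ℕ} {X : Motives.SchemeOver ℂ}

/-- **`Fᵏ(ℂ ⊗_ℚ Hᵏ) = Θ'⁻¹(H^{k,0})`, both inclusions**: an element of `ℂ ⊗_ℚ Hᵏ(X(ℂ); ℚ)` lies in the
last step `Fᵏ` of the Hodge filtration of `hodge hHD hX k` iff its image under `Θ'` is a class of Hodge
type `(k, 0)` — the model-free reading of `Fᵏ Hᵏ = H^{k,0}` (holomorphic `k`-forms), by which a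
consumer recognises classes of holomorphic forms in `(hodge hHD hX k).F k` without opening the chosen
Hodge model. [cite: VoisinHodgeI2002, §7.1.1 Def. 7.4 and §6.1.3 Cor. 6.12] -/
theorem mem_hodge_F_self_iff (hHD : exists_isReal_hodgeModel) (hI : hodgePQ_independent_of_hodgeModel)
    (hX : Motives.IsSmoothProjective n X) (k : ℕ)
    (x : ℂ ⊗[ℚ] bettiCohomology X k) :
    x ∈ (hodge hHD hX k).F k ↔ IsOfHodgeType n X k k 0 (ofRatClassBaseChange (Motives.ComplexPoints X) k x) := by
  refine ⟨isOfHodgeType_of_mem_F_self hHD hX k, fun ⟨B, hB⟩ ↦ ?_⟩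
  rw [hodge_F, HodgeModel.ratF_eq_iSup]
  have hmem : x ∈ (realHodgeModel hHD hX).ratPiece hX k k 0 := by
    rw [HodgeModel.mem_ratPiece_iff, HodgeModel.complexification_apply]
    exact hI n X hX B (realHodgeModel hHD hX) k k 0 _ hB
  refine Submodule.mem_iSup_of_mem ⟨(k, 0), Finset.HasAntidiagonal.mem_antidiagonal.2 (by omega)⟩ ?_
  exact Submodule.mem_iSup_of_mem (by push_cast; omega) hmem

/-- Degree one: `F¹(ℂ ⊗_ℚ H¹(X(ℂ); ℚ))` is exactly the preimage of the classes of type `(1,0)`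
(holomorphic one-forms). [cite: VoisinHodgeI2002, §7.1.1] -/
theorem mem_hodge_F_one_iff (hHD : exists_isReal_hodgeModel) (hI : hodgePQ_independent_of_hodgeModel)
    (hX : Motives.IsSmoothProjective n X) (x : ℂ ⊗[ℚ] bettiCohomology X 1) :
    x ∈ (hodge hHD hX 1).F 1 ↔ IsOfHodgeType n X 1 1 0 (ofRatClassBaseChange (Motives.ComplexPoints X) 1 x) :=
  mem_hodge_F_self_iff hHD hI hX 1 x

/-- **`V^{p,q} = Θ'⁻¹(H^{p,q})`, model-free**: for `p + q = k`, an element of `ℂ ⊗_ℚ Hᵏ(X(ℂ); ℚ)`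
lies in the `(p,q)`-piece `Fᵖ ∩ conj F^q` of `hodge hHD hX k` iff its image under `Θ'` is a class of
Hodge type `(p,q)` (for any, equivalently every, Hodge model). [cite: VoisinHodgeI2002, §7.1.1 Def. 7.4]
[cite: DeligneHodgeII1971, 1.2.5] -/
theorem mem_hodge_piece_iff (hHD : exists_isReal_hodgeModel) (hI : hodgePQ_independent_of_hodgeModel)
    (hX : Motives.IsSmoothProjective n X) {k p q : ℕ} (hpq : p + q = k)
    (x : ℂ ⊗[ℚ] bettiCohomology X k) :
    x ∈ (hodge hHD hX k).piece p q ↔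
      IsOfHodgeType n X k p q (ofRatClassBaseChange (Motives.ComplexPoints X) k x) := by
  change x ∈ ((realHodgeModel hHD hX).hodgeStructure hX (realHodgeModel_isHodgeSymmetric hHD hX) k).piece p q ↔ _
  rw [(realHodgeModel hHD hX).piece_eq_ratPiece hX (realHodgeModel_isHodgeSymmetric hHD hX) hpq,
    HodgeModel.mem_ratPiece_iff, HodgeModel.complexification_apply]
  exact ⟨fun h ↦ ⟨_, h⟩, fun ⟨B, hB⟩ ↦
    hI n X hX B (realHodgeModel hHD hX) k p q _ hB⟩

/-- Degree one, type `(1,0)`: **`(hodge hHD hX 1).piece 1 0 = Θ'⁻¹(H^{1,0})`** — the recognition lemma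
for an axiomatic consumer's `H¹·⁰(X) := (hodge X 1).piece 1 0` (classes of holomorphic one-forms).
[cite: VoisinHodgeI2002, §7.1.1] -/
theorem mem_hodge_piece_one_zero_iff (hHD : exists_isReal_hodgeModel)
    (hI : hodgePQ_independent_of_hodgeModel) (hX : Motives.IsSmoothProjective n X)
    (x : ℂ ⊗[ℚ] bettiCohomology X 1) :
    x ∈ (hodge hHD hX 1).piece 1 0 ↔
      IsOfHodgeType n X 1 1 0 (ofRatClassBaseChange (Motives.ComplexPoints X) 1 x) := by
  exact_mod_cast mem_hodge_piece_iff hHD hI hX (k := 1) (p := 1) (q := 0) rfl x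

/-- Degree two, type `(2,0)`: **`(hodge hHD hX 2).piece 2 0 = Θ'⁻¹(H^{2,0})`** (classes of holomorphic
two-forms, the target of a wedge of two `(1,0)`-classes). [cite: VoisinHodgeI2002, §7.1.1] -/
theorem mem_hodge_piece_two_zero_iff (hHD : exists_isReal_hodgeModel)
    (hI : hodgePQ_independent_of_hodgeModel) (hX : Motives.IsSmoothProjective n X)
    (x : ℂ ⊗[ℚ] bettiCohomology X 2) :
    x ∈ (hodge hHD hX 2).piece 2 0 ↔
      IsOfHodgeType n X 2 2 0 (ofRatClassBaseChange (Motives.ComplexPoints X) 2 x) := by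
  exact_mod_cast mem_hodge_piece_iff hHD hI hX (k := 2) (p := 2) (q := 0) rfl x

end HodgeFiltration

end BettiUniverse

end Literature.AlgebraicGeometry.HodgeTheory

end
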